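import Summits.BirchSwinnertonDyer.BirchSwinnertonDyer.Theorems.ManinLocalTwoThreeShimuraKernelCyclicNewform
import Summits.BirchSwinnertonDyer.BirchSwinnertonDyer.Theorems.ManinLocalTwoThreeNaturalTes75OfOptimalTwin
import HarnessLib

/-!
# The `f`-only cyclicity rows 2♮/1♮ with CES removed: modulo {Eichler–Shimura construction, modularity, T-es-75♮} (or T-es-75 ∧ CES-weak)
(route `ManinLocalTwoThree`, crux C2 `ManinOddAtFour` stmt-BirchSwinnertonDyer-22967; cell bsd-f2-manin, prover seat p2 gen 23;
`--supports stmt-BirchSwinnertonDyer-22967`; sequel of `…ShimuraKernelCyclicNewform` (p764996) over `…NaturalTes75Consumers` (p765191) and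
`…NaturalTes75OfOptimalTwin` (p765293))

`…ShimuraKernelCyclicNewform` proved desc's `f`-only rows `NewformShimuraKernelCyclic` / `NewformGamma1PeriodsNotInsideTwice` modulo
{`eichlerShimuraConstruction`, modularity, CES, T-es-75}.  With the natural Stevens statement T-es-75♮ (explicit binder, `…NaturalTes75Consumers`)
CES disappears; with T-es-75 as typed it is replaced by CES-weak (p3 gen 21's CES♭ shape, `…NaturalTes75OfOptimalTwin`).

* `newformShimuraKernelCyclic_of_ES_modularity_naturalTes75 : eichlerShimuraConstruction → exists_isNewformOf → T-es-75♮ → NewformShimuraKernelCyclic`;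
* `newformGamma1PeriodsNotInsideTwice_of_ES_modularity_naturalTes75` (row 1♮); `newformShimuraKernelCyclic_of_ES_modularity_Tes75_CESweak`.

HONEST FRAMING: CONDITIONAL glue on statement-only printed facts / explicit binders; nothing about C2, Manin's conjecture or BSD is proved.
No definitions, no sorry. [cite: Knapp1993, Thm. 11.74] [cite: Vatsal2005, Conj. 1.9] [cite: Stevens1982, §1.3 Thm. 1.3.1 (b)]
-/

set_option autoImplicit false
-- lint-debt: the directory name repeats the summit name (sibling precedent `ManinLocalTwoThreeShimuraKernelCyclicNewform.lean`)
set_option linter.dupNamespace false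

noncomputable section

open scoped MatrixGroups ModularForm
open CongruenceSubgroup WeierstrassCurve Literature.NumberTheory.EllipticCurves Literature.NumberTheory.EllipticCurves.ModularForms
open Summit.BirchSwinnertonDyer.Rank1Residual.ManinAdditive

namespace Summit.BirchSwinnertonDyer.BirchSwinnertonDyer.Theorems.ManinLocalTwoThree.NaturalTes75

section Natural

/- T-es-75♮ (Stevens 1982 Thm. 1.3.1 (b) without the optimality binder), explicit hypothesis as in `…NaturalTes75Consumers`. -/
variable (hSt : ∀ (W : WeierstrassCurve ℚ) [W.IsElliptic] {N : ℕ} [NeZero N] (D : Gamma1ParametrizationData W N)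
    (σ : ℂ ≃ₐ[ℚ] ℂ) (d d' : ℤ), ((d * d' : ℤ) : ZMod N) = 1 →
    σ (Complex.exp (2 * Real.pi * Complex.I / N)) = Complex.exp (2 * Real.pi * Complex.I * d / N) →
    ∀ y : ℤ, y ≠ 0 →
      Affine.Point.map (W' := W) (σ : ℂ →ₐ[ℚ] ℂ) (D.uniformize ((D.c : ℂ) * modularSymbol D.f (1 / y))) =
        D.uniformize ((D.c : ℂ) * modularSymbol D.f (1 / (d' * y))))

include hSt

/-- **Row 2♮ `NewformShimuraKernelCyclic` ⟸ {Eichler–Shimura construction, modularity, T-es-75♮}**: the carrier datum of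
`ShimuraKernelCyclicOfFacts.exists_datum_of_eichlerShimuraConstruction` and the CES-free carrier row `shimuraKernelCyclic_of_modularity_naturalTes75`.
CONDITIONAL. [cite: Knapp1993, Thm. 11.74 (d)(e)] [cite: Vatsal2005, Conj. 1.9] -/
theorem newformShimuraKernelCyclic_of_ES_modularity_naturalTes75 (hES : eichlerShimuraConstruction) (hnf : exists_isNewformOf) :
    ShimuraCyclic.NewformShimuraKernelCyclic := by
  intro N _ f hf hQ
  obtain ⟨W₀, _, D₀, hD₀⟩ := ShimuraKernelCyclicOfFacts.exists_datum_of_eichlerShimuraConstruction hES f hf hQ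
  rw [← hD₀]
  exact shimuraKernelCyclic_of_modularity_naturalTes75 hSt hnf W₀ D₀

/-- **Row 1♮ `NewformGamma1PeriodsNotInsideTwice` ⟸ {Eichler–Shimura construction, modularity, T-es-75♮}** (desc's glue). CONDITIONAL.
[cite: Stevens1989, §2] -/
theorem newformGamma1PeriodsNotInsideTwice_of_ES_modularity_naturalTes75 (hES : eichlerShimuraConstruction) (hnf : exists_isNewformOf) :
    ShimuraCyclic.NewformGamma1PeriodsNotInsideTwice :=
  ShimuraCyclic.newformNotInsideTwice_of_newformCyclic (newformShimuraKernelCyclic_of_ES_modularity_naturalTes75 hSt hES hnf)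

end Natural

/-- **Row 2♮ ⟸ {Eichler–Shimura construction, modularity, T-es-75, CES-weak}** (T-es-75♮ from the bridge `naturalTes75_of_modularity_CESweak_Tes75`;
CES-weak is p3 gen 21's CES♭ shape, or CES as typed by `cesWeak_of_CES`).  CONDITIONAL. [cite: Stevens1982, §1.3 Thm. 1.3.1 (b)] [cite: Vatsal2005, Conj. 1.9] -/
theorem newformShimuraKernelCyclic_of_ES_modularity_Tes75_CESweak (hES : eichlerShimuraConstruction) (hnf : exists_isNewformOf)
    (hSt : optimalGamma1Parametrization_cuspInv_galoisAction)
    (hCESw : ∀ (W₀ : WeierstrassCurve ℚ) [W₀.IsElliptic] [W₀.IsGloballyMinimal] {N : ℕ} [NeZero N] (D₀ : ModularParametrizationData W₀ N),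
      (∀ z ∈ D₀.L.lattice, ∃ w ∈ periodLattice D₀.f, z = D₀.c * w) →
      ∃ (E₁ : WeierstrassCurve ℚ) (_ : E₁.IsElliptic) (D₁ : Gamma1ParametrizationData E₁ N), D₁.IsOptimal ∧ D₁.f = D₀.f) :
    ShimuraCyclic.NewformShimuraKernelCyclic :=
  newformShimuraKernelCyclic_of_ES_modularity_naturalTes75
    (fun W _ _ _ D σ d d' hdd' hσ y hy ↦ naturalTes75_of_modularity_CESweak_Tes75 hnf hCESw hSt W D σ d d' hdd' hσ y hy) hES hnf

end Summit.BirchSwinnertonDyer.BirchSwinnertonDyer.Theorems.ManinLocalTwoThree.NaturalTes75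

end
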